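import Literature.Topology.PlaneTopology.SimpleArcs
import Literature.Topology.PlaneTopology.ArcTrimming
import HarnessLib

/-!
# Simple arcs: homeomorphic parametrisations, sub-paths, first hits

Plumbing between the two presentations of Jordan arcs used in the tree — `IsSimpleArc L a b`
(`SimpleArcs`, a continuous injective parametrisation on `[0,1]`) and homeomorphisms
`e : [0,1] ≃ₜ L` (`ArcTrimming`, `ArcInversion`, …) — and two constructions:

* `IsSimpleArc.exists_homeomorph` — a simple arc from `a` to `b` is `e : [0,1] ≃ₜ L` with
  `e 0 = a`, `e 1 = b`;
* `isSimpleArc_image_Icc` — a sub-path `γ[a', b']` of a path continuous and injective on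
  `[0, 1]` is a simple arc;
* `exists_first_hit` — **first hit**: a path from outside a closed set `C` to a point of `C`
  has a first parameter in `C`; the initial sub-path meets `C` only at its endpoint.

All folklore.
-/

noncomputable section

open Set Filter Topology Function unitInterval

open scoped unitInterval

namespace Literature.Topology.PlaneTopology

/-- **A simple arc is a homeomorph of `[0,1]`** with the expected endpoints. [folklore] -/
theorem IsSimpleArc.exists_homeomorph {L : Set ℂ} {a b : ℂ} (h : IsSimpleArc L a b) :
    ∃ e : I ≃ₜ L, ((e 0 : L) : ℂ) = a ∧ ((e 1 : L) : ℂ) = b := by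
  obtain ⟨γ, hγ, hinj, hL, h0, h1⟩ := isSimpleArc_iff_continuous.1 h
  set g : I → ℂ := fun t ↦ γ t with hg
  have hgc : Continuous g := hγ.comp continuous_subtype_val
  have hginj : Injective g := fun s t hst ↦ Subtype.ext (hinj s.2 t.2 hst)
  obtain ⟨e, he⟩ := exists_arc_of_injective hgc hginj
  have hrange : range g = L := by
    rw [← hL]; ext z; constructor
    · rintro ⟨t, rfl⟩; exact ⟨t, t.2, rfl⟩
    · rintro ⟨t, ht, rfl⟩; exact ⟨⟨t, ht⟩, rfl⟩
  refine ⟨e.trans (Homeomorph.setCongr hrange), ?_, ?_⟩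
  · show ((e 0 : range g) : ℂ) = a
    rw [he]; exact h0
  · show ((e 1 : range g) : ℂ) = b
    rw [he]; exact h1

/-- **Sub-paths are simple arcs**: for `γ` continuous and injective on `[0, 1]` and
`0 ≤ a' < b' ≤ 1`, `γ[a', b']` is a simple arc from `γ a'` to `γ b'`. [folklore] -/
theorem isSimpleArc_image_Icc {γ : ℝ → ℂ} (hγ : ContinuousOn γ (Icc 0 1)) (hinj : InjOn γ (Icc 0 1))
    {a' b' : ℝ} (ha : 0 ≤ a') (hab : a' < b') (hb : b' ≤ 1) :
    IsSimpleArc (γ '' Icc a' b') (γ a') (γ b') := by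
  set φ : ℝ → ℝ := fun s ↦ a' + s * (b' - a') with hφ
  have hφc : Continuous φ := continuous_const.add (continuous_id.mul continuous_const)
  have hφmem : ∀ s ∈ Icc (0 : ℝ) 1, φ s ∈ Icc a' b' := fun s hs ↦
    ⟨by rw [hφ]; dsimp only; nlinarith [hs.1], by rw [hφ]; dsimp only; nlinarith [hs.2]⟩
  have hsub : Icc a' b' ⊆ Icc (0 : ℝ) 1 := Icc_subset_Icc ha hb
  have hφimage : φ '' Icc 0 1 = Icc a' b' := by
    refine Subset.antisymm (fun _ ⟨s, hs, hst⟩ ↦ hst ▸ hφmem s hs) fun t ht ↦ ?_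
    refine ⟨(t - a') / (b' - a'), ⟨div_nonneg (by linarith [ht.1]) (by linarith),
      (div_le_one (by linarith)).2 (by linarith [ht.2])⟩, ?_⟩
    rw [hφ]; dsimp only
    have hne : b' - a' ≠ 0 := by linarith
    field_simp
    ring
  refine ⟨γ ∘ φ, hγ.comp hφc.continuousOn fun s hs ↦ hsub (hφmem s hs), ?_, ?_, ?_, ?_⟩
  · intro s hs t ht hst
    have h1 := hinj (hsub (hφmem s hs)) (hsub (hφmem t ht)) hst
    rw [hφ] at h1; dsimp only at h1
    have hne : b' - a' ≠ 0 := by linarith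
    have : s * (b' - a') = t * (b' - a') := by linarith
    exact mul_right_cancel₀ hne this
  · rw [image_comp, hφimage]
  · simp [hφ]
  · simp [hφ]

/-- **First hit of a closed set along a path.** If `η` is continuous on `[0, 1]`, `η 0 ∉ C`,
`η 1 ∈ C` and `C` is closed, there is a first parameter `u₁ ∈ (0, 1]` with `η u₁ ∈ C`, and
`η u ∉ C` for `u < u₁`. [folklore] -/
theorem exists_first_hit {η : ℝ → ℂ} (hη : ContinuousOn η (Icc 0 1)) {C : Set ℂ} (hC : IsClosed C)
    (h0 : η 0 ∉ C) (h1 : η 1 ∈ C) :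
    ∃ u₁ ∈ Ioc (0 : ℝ) 1, η u₁ ∈ C ∧ ∀ u ∈ Ico (0 : ℝ) u₁, η u ∉ C := by
  set S : Set ℝ := {u | u ∈ Icc (0 : ℝ) 1 ∧ η u ∈ C} with hS
  have hScl : IsClosed S := by
    have : S = Icc (0 : ℝ) 1 ∩ η ⁻¹' C := by ext u; simp [hS]
    rw [this]
    exact hη.preimage_isClosed_of_isClosed isClosed_Icc hC
  have hSne : S.Nonempty := ⟨1, ⟨zero_le_one, le_rfl⟩, h1⟩
  have hSbdd : BddBelow S := ⟨0, fun u hu ↦ hu.1.1⟩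
  set u₁ : ℝ := sInf S with hu₁
  have hu₁S : u₁ ∈ S := hScl.csInf_mem hSne hSbdd
  have hu₁pos : 0 < u₁ := by
    rcases hu₁S.1.1.eq_or_lt with h | h
    · exfalso; have := hu₁S.2; rw [← h] at this; exact h0 this
    · exact h
  refine ⟨u₁, ⟨hu₁pos, hu₁S.1.2⟩, hu₁S.2, fun u hu huC ↦ ?_⟩
  have : u₁ ≤ u := csInf_le hSbdd ⟨⟨hu.1, hu.2.le.trans hu₁S.1.2⟩, huC⟩
  linarith [hu.2]

end Literature.Topology.PlaneTopology
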